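import Summits.AtomisticToContinuum.Crystallization.Theorems.ExcessDecayLiouvillePhononStabilityDefs

/-!
# `PhononStability` (stmt-AtomisticToContinuum-9333), line `contragredient-window-collapse`: stub `stub_dilation`

Reduction S4 of the line (`DilationReduction`, (12,6) bi-homogeneity on the truncated-with-tail form):
given the window geometry (bond-graph constancy on the window), `κ ≥ 0`, a range `R`, a window cell `A`
with shift error `δ`, a metric `B` and a label field `w`, there is a dilation `s > 0` with `s • A` on the
dilation-extreme sheet `ExtWindow` and `s¹⁰ · GR κ R (sA) (s⁻¹B) δ w ≤ GR κ R A B δ w`.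

* **Endpoints.** By compactness of the unit sphere, `‖A·‖` attains its minimum `m ≥ 189/200` and its
  maximum `M ≤ 199/200` on it; `s₀ := (189/200)/m ≤ 1` puts `s₀A` on the lower-stretch sheet and
  `s₁ := (199/200)/M` or `(1/40)/‖Aδ‖` (whichever binds first) `≥ 1` puts `s₁A` on the upper-stretch or
  maximal-shift sheet; both stay in the window.
* **Closed form.** With bond-graph constancy at `sA` (first conjunct of `WindowGeometry`),
  `Nform (sA) (s⁻¹B) = s⁻² Σ_nn Y_c`, and the exact identities `s¹⁰ω(sr) = 14s⁻⁶r⁻¹⁶ − 8r⁻¹⁰`,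
  `s⁸ψ(sr) = −s⁻⁶r⁻¹⁴ + r⁻⁸` give `s¹⁰·GR(sA, s⁻¹B) = s⁻⁶P + Q − s¹⁰T − s⁸K` with `T = tailForm R w ≥ 0`,
  `K = 2κ Σ_nn Y_c ≥ 0`.
* **Concavity in `σ = s⁻⁶`.** The tangent-line inequalities at `σ = 1`, `s¹⁰ ≥ 1 − (5/3)(s⁻⁶ − 1)` and
  `s⁸ ≥ 1 − (4/3)(s⁻⁶ − 1)` (i.e. `3s¹⁶ − 8s⁶ + 5 = (s² − 1)²·(…) ≥ 0`, `3s¹⁴ − 7s⁶ + 4 = (s² − 1)²·(…) ≥ 0`),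
  give `F(s) ≤ F(1) + (s⁻⁶ − 1)·a` with `a = P + (5/3)T + (4/3)K`; choosing `s = s₁` if `a ≥ 0` and `s = s₀`
  otherwise makes the correction nonpositive, and `F(1) = GR κ R A B δ w`.

All `[folklore]`.
-/

noncomputable section

open scoped BigOperators Classical InnerProductSpace
open Filter Set Function
open Literature.MathematicalPhysics.StatisticalMechanics
open Summit.AtomisticToContinuum.Crystallization.Theses.ExcessDecayLiouville
open Summit.AtomisticToContinuum.Crystallization.Theorems.PhononStabilityNegative
open Summit.AtomisticToContinuum.Crystallization.Theorems.PhononStabilityCWC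

namespace Summit.AtomisticToContinuum.Crystallization.Theorems.PhononStabilityCWC.DilationStub

/-! ## Copies of the line's Basics lemmas (not yet in the tree) -/

/-- `Y_c ≥ 0`; copy of the line's Basics lemma. [folklore] -/
private theorem metricForm_nonneg (B : EuclideanSpace ℝ (Fin 3) →L[ℝ] EuclideanSpace ℝ (Fin 3))
    (c : BondClass) (w : Label → EuclideanSpace ℝ (Fin 3)) : 0 ≤ metricForm B c w :=
  tsum_nonneg fun _ => by positivity

/-- `Σ_k ‖Δ_c w k‖² ≥ 0`; copy of the line's Basics lemma. [folklore] -/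
private theorem plainForm_nonneg (c : BondClass) (w : Label → EuclideanSpace ℝ (Fin 3)) :
    0 ≤ plainForm c w :=
  tsum_nonneg fun _ => by positivity

/-- `farCoeff ≥ 0`; copy of the line's Basics lemma. [folklore] -/
private theorem farCoeff_nonneg (c : BondClass) : 0 ≤ farCoeff c := by
  unfold farCoeff; positivity

/-- The tail functional is nonnegative; copy of the line's Basics lemma. [folklore] -/
private theorem tailForm_nonneg (R : ℝ) (w : Label → EuclideanSpace ℝ (Fin 3)) : 0 ≤ tailForm R w :=
  tsum_nonneg fun c => by
    by_cases hc : c ∈ classesR R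
    · simp [hc]
    · simp only [hc, if_false]; exact mul_nonneg (farCoeff_nonneg c) (plainForm_nonneg c w)

/-- The metric functional of a diagonal class vanishes; copy of the line's Basics lemma. [folklore] -/
private theorem metricForm_diag (B : EuclideanSpace ℝ (Fin 3) →L[ℝ] EuclideanSpace ℝ (Fin 3))
    (w : Label → EuclideanSpace ℝ (Fin 3)) {c : BondClass} (hc : diagClass c) :
    metricForm B c w = 0 := by
  obtain ⟨m, m', n⟩ := c
  obtain ⟨h1, h2⟩ := hc
  simp only at h1 h2
  subst h1; subst h2
  simp [metricForm, bondDiff]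

/-- Bond-graph constancy turns the metric cut-off of `Nform` into the finite nearest-neighbour sum; copy of
the line's Basics lemma. [folklore] -/
private theorem Nform_eq_sum {A B : EuclideanSpace ℝ (Fin 3) →L[ℝ] EuclideanSpace ℝ (Fin 3)}
    {δ : EuclideanSpace ℝ (Fin 3)} {w : Label → EuclideanSpace ℝ (Fin 3)}
    (hgraph : ∀ c : BondClass, ¬ diagClass c → (c ∈ nnClasses ↔ ‖A (bondVec δ c)‖ ≤ 11 / 10)) :
    Nform A B δ w = ∑ c ∈ nnClasses, metricForm B c w := by
  have key : ∀ c : BondClass, (if ‖A (bondVec δ c)‖ ≤ 11 / 10 then metricForm B c w else 0) =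
      if c ∈ nnClasses then metricForm B c w else 0 := by
    intro c
    by_cases hd : diagClass c
    · simp [metricForm_diag B w hd]
    · by_cases hc : c ∈ nnClasses
      · rw [if_pos ((hgraph c hd).1 hc), if_pos hc]
      · rw [if_neg (fun h => hc ((hgraph c hd).2 h)), if_neg hc]
  unfold Nform
  rw [tsum_congr key, tsum_eq_sum (s := nnClasses) (fun c hc => if_neg hc)]
  exact Finset.sum_congr rfl fun c hc => if_pos hc

/-! ## Scaling identities along the dilation family `(sA, s⁻¹B)` -/

/-- `‖(s • A) x‖ = s‖A x‖` for `s ≥ 0`. [folklore] -/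
private theorem norm_dilate_apply {s : ℝ} (hs : 0 ≤ s)
    (A : EuclideanSpace ℝ (Fin 3) →L[ℝ] EuclideanSpace ℝ (Fin 3)) (x : EuclideanSpace ℝ (Fin 3)) :
    ‖(s • A) x‖ = s * ‖A x‖ := by
  change ‖s • A x‖ = s * ‖A x‖
  rw [norm_smul, Real.norm_of_nonneg hs]

/-- The metric functional is `2`-homogeneous in the metric: `Y_c(tB, w) = t²·Y_c(B, w)`. [folklore] -/
theorem metricForm_smul (t : ℝ) (B : EuclideanSpace ℝ (Fin 3) →L[ℝ] EuclideanSpace ℝ (Fin 3))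
    (c : BondClass) (w : Label → EuclideanSpace ℝ (Fin 3)) :
    metricForm (t • B) c w = t ^ 2 * metricForm B c w := by
  unfold metricForm
  rw [← tsum_mul_left]
  refine tsum_congr fun k => ?_
  change ‖t • B (bondDiff c w k)‖ ^ 2 = t ^ 2 * ‖B (bondDiff c w k)‖ ^ 2
  rw [norm_smul, mul_pow, Real.norm_eq_abs, sq_abs]

/-- `3s¹⁶ − 8s⁶ + 5 = (s² − 1)²(3s¹² + 6s¹⁰ + 9s⁸ + 12s⁶ + 15s⁴ + 10s² + 5) ≥ 0`
(tangent line of `σ ↦ σ^{-5/3}` at `σ = 1`, `σ = s⁻⁶`). [folklore] -/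
theorem poly16_nonneg (s : ℝ) : 0 ≤ 3 * s ^ 16 - 8 * s ^ 6 + 5 := by
  have h : 3 * s ^ 16 - 8 * s ^ 6 + 5 = (s ^ 2 - 1) ^ 2 *
      (3 * s ^ 12 + 6 * s ^ 10 + 9 * s ^ 8 + 12 * s ^ 6 + 15 * s ^ 4 + 10 * s ^ 2 + 5) := by ring
  rw [h]; positivity

/-- `3s¹⁴ − 7s⁶ + 4 = (s² − 1)²(3s¹⁰ + 6s⁸ + 9s⁶ + 12s⁴ + 8s² + 4) ≥ 0`
(tangent line of `σ ↦ σ^{-4/3}` at `σ = 1`, `σ = s⁻⁶`). [folklore] -/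
theorem poly14_nonneg (s : ℝ) : 0 ≤ 3 * s ^ 14 - 7 * s ^ 6 + 4 := by
  have h : 3 * s ^ 14 - 7 * s ^ 6 + 4 = (s ^ 2 - 1) ^ 2 *
      (3 * s ^ 10 + 6 * s ^ 8 + 9 * s ^ 6 + 12 * s ^ 4 + 8 * s ^ 2 + 4) := by ring
  rw [h]; positivity

/-- **Concavity in `σ = s⁻⁶` (tangent-line form):** for `T, K ≥ 0` and `s > 0`,
`s⁻⁶P + Q − s¹⁰T − s⁸K ≤ (P + Q − T − K) + (s⁻⁶ − 1)(P + (5/3)T + (4/3)K)`. [folklore] -/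
theorem tangent_bound (P Q T K : ℝ) (hT : 0 ≤ T) (hK : 0 ≤ K) {s : ℝ} (hs : 0 < s) :
    s⁻¹ ^ 6 * P + Q - s ^ 10 * T - s ^ 8 * K ≤
      (P + Q - T - K) + (s⁻¹ ^ 6 - 1) * (P + 5 / 3 * T + 4 / 3 * K) := by
  have hσ : s⁻¹ ^ 6 = (s ^ 6)⁻¹ := inv_pow s 6
  have hs6 : (s ^ 6) ≠ 0 := by positivity
  have h1 : 0 ≤ s ^ 10 - 1 + 5 / 3 * (s⁻¹ ^ 6 - 1) := by
    have e : s ^ 10 - 1 + 5 / 3 * (s⁻¹ ^ 6 - 1) = (3 * s ^ 16 - 8 * s ^ 6 + 5) / (3 * s ^ 6) := by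
      rw [hσ]; field_simp; ring
    rw [e]; exact div_nonneg (poly16_nonneg s) (by positivity)
  have h2 : 0 ≤ s ^ 8 - 1 + 4 / 3 * (s⁻¹ ^ 6 - 1) := by
    have e : s ^ 8 - 1 + 4 / 3 * (s⁻¹ ^ 6 - 1) = (3 * s ^ 14 - 7 * s ^ 6 + 4) / (3 * s ^ 6) := by
      rw [hσ]; field_simp; ring
    rw [e]; exact div_nonneg (poly14_nonneg s) (by positivity)
  nlinarith [mul_nonneg hT h1, mul_nonneg hK h2]

/-- **The (12,6) identities per class:** for `s > 0`,
`s¹⁰ · classTerm (sA) (s⁻¹B) δ w c = s⁻⁶(14r⁻¹⁶X − r⁻¹⁴Y) + (−8r⁻¹⁰X + r⁻⁸Y)` with `r = ‖Aζ_c(δ)‖`,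
`X = longForm δ c w`, `Y = metricForm B c w` (valid also for `r = 0`). [folklore] -/
theorem classTerm_dilate {s : ℝ} (hs : 0 < s)
    (A B : EuclideanSpace ℝ (Fin 3) →L[ℝ] EuclideanSpace ℝ (Fin 3)) (δ : EuclideanSpace ℝ (Fin 3))
    (w : Label → EuclideanSpace ℝ (Fin 3)) (c : BondClass) :
    s ^ 10 * classTerm (s • A) (s⁻¹ • B) δ w c =
      s⁻¹ ^ 6 * (14 * ‖A (bondVec δ c)‖⁻¹ ^ 16 * longForm δ c w -
          ‖A (bondVec δ c)‖⁻¹ ^ 14 * metricForm B c w) +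
        (-8 * ‖A (bondVec δ c)‖⁻¹ ^ 10 * longForm δ c w + ‖A (bondVec δ c)‖⁻¹ ^ 8 * metricForm B c w) := by
  unfold classTerm omegaLJ psiLJ
  rw [norm_dilate_apply hs.le, metricForm_smul]
  generalize ‖A (bondVec δ c)‖ = r
  generalize longForm δ c w = X
  generalize metricForm B c w = Y
  have h10 : s ^ 10 * s⁻¹ ^ 10 = 1 := by rw [← mul_pow, mul_inv_cancel₀ hs.ne', one_pow]
  simp only [mul_inv, mul_pow]
  linear_combination
    (14 * r⁻¹ ^ 16 * X * s⁻¹ ^ 6 - 8 * r⁻¹ ^ 10 * X - r⁻¹ ^ 14 * Y * s⁻¹ ^ 6 + r⁻¹ ^ 8 * Y) * h10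

/-- **Closed form along the dilation family:** there are `P Q N` (`N = Σ_nn Y_c ≥ 0`) with
`s¹⁰ · GR κ R (sA) (s⁻¹B) δ w = s⁻⁶P + Q − s¹⁰·tailForm R w − s⁸·(2κN)` for every `s > 0` at which the
metric bond graph of `sA` is the reference nearest-neighbour graph. [folklore] -/
theorem GR_dilate (κ R : ℝ) (A B : EuclideanSpace ℝ (Fin 3) →L[ℝ] EuclideanSpace ℝ (Fin 3))
    (δ : EuclideanSpace ℝ (Fin 3)) (w : Label → EuclideanSpace ℝ (Fin 3)) :
    ∃ P Q N : ℝ, 0 ≤ N ∧ ∀ s : ℝ, 0 < s →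
      (∀ c : BondClass, ¬ diagClass c → (c ∈ nnClasses ↔ ‖(s • A) (bondVec δ c)‖ ≤ 11 / 10)) →
        s ^ 10 * GR κ R (s • A) (s⁻¹ • B) δ w =
          s⁻¹ ^ 6 * P + Q - s ^ 10 * tailForm R w - s ^ 8 * (2 * κ * N) := by
  set P : ℝ := ∑ c ∈ classesR R, (14 * ‖A (bondVec δ c)‖⁻¹ ^ 16 * longForm δ c w -
      ‖A (bondVec δ c)‖⁻¹ ^ 14 * metricForm B c w) with hP
  set Q : ℝ := ∑ c ∈ classesR R, (-8 * ‖A (bondVec δ c)‖⁻¹ ^ 10 * longForm δ c w +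
      ‖A (bondVec δ c)‖⁻¹ ^ 8 * metricForm B c w) with hQ
  set N : ℝ := ∑ c ∈ nnClasses, metricForm B c w with hN
  refine ⟨P, Q, N, Finset.sum_nonneg fun c _ => metricForm_nonneg B c w, fun s hs hgraph => ?_⟩
  have hS : s ^ 10 * ∑ c ∈ classesR R, classTerm (s • A) (s⁻¹ • B) δ w c = s⁻¹ ^ 6 * P + Q := by
    rw [hP, hQ, Finset.mul_sum, Finset.mul_sum, ← Finset.sum_add_distrib]
    exact Finset.sum_congr rfl fun c _ => classTerm_dilate hs A B δ w c
  have hN' : ∑ c ∈ nnClasses, metricForm (s⁻¹ • B) c w = s⁻¹ ^ 2 * N := by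
    rw [hN, Finset.mul_sum]
    exact Finset.sum_congr rfl fun c _ => metricForm_smul s⁻¹ B c w
  have h8 : s ^ 10 * s⁻¹ ^ 2 = s ^ 8 := by
    rw [show s ^ 10 = s ^ 8 * s ^ 2 by ring, mul_assoc, ← mul_pow, mul_inv_cancel₀ hs.ne', one_pow,
      mul_one]
  unfold GR
  rw [Nform_eq_sum hgraph, mul_sub, mul_sub, hS, hN']
  linear_combination (-(2 * κ * N)) * h8

/-! ## The two dilation-extreme endpoints -/

/-- **Lower endpoint:** some `s₀ ∈ (0, 1]` puts `s₀A` on the lower-stretch sheet of the window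
(`s₀ = (189/200)/min_{‖x‖=1} ‖Ax‖`, the minimum existing by compactness of the unit sphere). [folklore] -/
theorem exists_lower {A : EuclideanSpace ℝ (Fin 3) →L[ℝ] EuclideanSpace ℝ (Fin 3)}
    {δ : EuclideanSpace ℝ (Fin 3)} (hW : CellWindow A) (hδ : ShiftWindow A δ) :
    ∃ s : ℝ, 0 < s ∧ s ≤ 1 ∧ ExtWindow (s • A) δ := by
  obtain ⟨x₀, hx₀, hmin⟩ := (isCompact_sphere (0 : EuclideanSpace ℝ (Fin 3)) 1).exists_isMinOn
    ⟨EuclideanSpace.single 0 1, by simp⟩ (A.continuous.norm).continuousOn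
  have hx₀1 : ‖x₀‖ = 1 := mem_sphere_zero_iff_norm.mp hx₀
  have hx₀ne : x₀ ≠ 0 := by
    intro h; rw [h, norm_zero] at hx₀1; exact zero_ne_one hx₀1
  set m : ℝ := ‖A x₀‖ with hm
  have hm1 : 189 / 200 ≤ m := by have h := (hW x₀).1; rw [hx₀1, mul_one] at h; exact h
  have hmpos : 0 < m := by linarith
  have hmx : ∀ x : EuclideanSpace ℝ (Fin 3), m * ‖x‖ ≤ ‖A x‖ := by
    intro x
    by_cases hx : x = 0
    · rw [hx]; simp
    · have hxn : 0 < ‖x‖ := norm_pos_iff.mpr hx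
      have hy : ‖x‖⁻¹ • x ∈ Metric.sphere (0 : EuclideanSpace ℝ (Fin 3)) 1 := by
        rw [mem_sphere_zero_iff_norm, norm_smul, norm_inv, norm_norm, inv_mul_cancel₀ hxn.ne']
      have h := isMinOn_iff.mp hmin _ hy
      rw [map_smul, norm_smul, norm_inv, norm_norm, inv_mul_eq_div, le_div_iff₀ hxn] at h
      exact h
  have hs1 : 189 / 200 / m ≤ 1 := (div_le_one hmpos).mpr hm1
  refine ⟨189 / 200 / m, by positivity, hs1, fun x => ?_, ?_, Or.inl ⟨x₀, hx₀ne, ?_⟩⟩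
  · rw [norm_dilate_apply (by positivity)]
    constructor
    · calc 189 / 200 * ‖x‖ = 189 / 200 / m * (m * ‖x‖) := by field_simp
        _ ≤ 189 / 200 / m * ‖A x‖ := by gcongr; exact hmx x
    · calc 189 / 200 / m * ‖A x‖ ≤ 1 * ‖A x‖ := by gcongr
        _ = ‖A x‖ := one_mul _
        _ ≤ 199 / 200 * ‖x‖ := (hW x).2
  · show ‖((189 / 200 / m) • A) δ‖ ≤ 1 / 40
    rw [norm_dilate_apply (by positivity)]
    calc 189 / 200 / m * ‖A δ‖ ≤ 1 * ‖A δ‖ := by gcongr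
      _ = ‖A δ‖ := one_mul _
      _ ≤ 1 / 40 := hδ
  · rw [norm_dilate_apply (by positivity), hx₀1, ← hm]; field_simp

/-- **Upper endpoint:** some `s₁ ≥ 1` puts `s₁A` on the upper-stretch or maximal-shift sheet of the window
(`s₁ = (199/200)/max_{‖x‖=1} ‖Ax‖` or `(1/40)/‖Aδ‖`, whichever binds first). [folklore] -/
theorem exists_upper {A : EuclideanSpace ℝ (Fin 3) →L[ℝ] EuclideanSpace ℝ (Fin 3)}
    {δ : EuclideanSpace ℝ (Fin 3)} (hW : CellWindow A) (hδ : ShiftWindow A δ) :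
    ∃ s : ℝ, 1 ≤ s ∧ ExtWindow (s • A) δ := by
  obtain ⟨x₀, hx₀, hmax⟩ := (isCompact_sphere (0 : EuclideanSpace ℝ (Fin 3)) 1).exists_isMaxOn
    ⟨EuclideanSpace.single 0 1, by simp⟩ (A.continuous.norm).continuousOn
  have hx₀1 : ‖x₀‖ = 1 := mem_sphere_zero_iff_norm.mp hx₀
  have hx₀ne : x₀ ≠ 0 := by
    intro h; rw [h, norm_zero] at hx₀1; exact zero_ne_one hx₀1
  set M : ℝ := ‖A x₀‖ with hM
  have hM1 : M ≤ 199 / 200 := by have h := (hW x₀).2; rw [hx₀1, mul_one] at h; exact h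
  have hMpos : 0 < M := by have h := (hW x₀).1; rw [hx₀1, mul_one] at h; linarith
  have hMx : ∀ x : EuclideanSpace ℝ (Fin 3), ‖A x‖ ≤ M * ‖x‖ := by
    intro x
    by_cases hx : x = 0
    · rw [hx]; simp
    · have hxn : 0 < ‖x‖ := norm_pos_iff.mpr hx
      have hy : ‖x‖⁻¹ • x ∈ Metric.sphere (0 : EuclideanSpace ℝ (Fin 3)) 1 := by
        rw [mem_sphere_zero_iff_norm, norm_smul, norm_inv, norm_norm, inv_mul_cancel₀ hxn.ne']
      have h := isMaxOn_iff.mp hmax _ hy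
      rw [map_smul, norm_smul, norm_inv, norm_norm, inv_mul_eq_div, div_le_iff₀ hxn] at h
      exact h
  have hsa : 1 ≤ 199 / 200 / M := (one_le_div hMpos).mpr hM1
  by_cases hcase : 199 / 200 / M * ‖A δ‖ ≤ 1 / 40
  · refine ⟨199 / 200 / M, hsa, fun x => ?_, ?_, Or.inr (Or.inl ⟨x₀, hx₀ne, ?_⟩)⟩
    · rw [norm_dilate_apply (by positivity)]
      constructor
      · calc 189 / 200 * ‖x‖ ≤ ‖A x‖ := (hW x).1
          _ = 1 * ‖A x‖ := (one_mul _).symm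
          _ ≤ 199 / 200 / M * ‖A x‖ := by gcongr
      · calc 199 / 200 / M * ‖A x‖ ≤ 199 / 200 / M * (M * ‖x‖) := by gcongr; exact hMx x
          _ = 199 / 200 * ‖x‖ := by field_simp
    · show ‖((199 / 200 / M) • A) δ‖ ≤ 1 / 40
      rw [norm_dilate_apply (by positivity)]; exact hcase
    · rw [norm_dilate_apply (by positivity), hx₀1, ← hM]; field_simp
  · push Not at hcase
    have hAδ : 0 < ‖A δ‖ := by
      rcases (norm_nonneg (A δ)).eq_or_lt with h | h
      · rw [← h, mul_zero] at hcase; norm_num at hcase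
      · exact h
    have hs1 : 1 ≤ 1 / 40 / ‖A δ‖ := (one_le_div hAδ).mpr hδ
    have hs2 : 1 / 40 / ‖A δ‖ ≤ 199 / 200 / M := by rw [div_le_iff₀ hAδ]; exact hcase.le
    refine ⟨1 / 40 / ‖A δ‖, hs1, fun x => ?_, ?_, Or.inr (Or.inr ?_)⟩
    · rw [norm_dilate_apply (by positivity)]
      constructor
      · calc 189 / 200 * ‖x‖ ≤ ‖A x‖ := (hW x).1
          _ = 1 * ‖A x‖ := (one_mul _).symm
          _ ≤ 1 / 40 / ‖A δ‖ * ‖A x‖ := by gcongr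
      · calc 1 / 40 / ‖A δ‖ * ‖A x‖ ≤ 199 / 200 / M * (M * ‖x‖) := by gcongr; exact hMx x
          _ = 199 / 200 * ‖x‖ := by field_simp
    · show ‖((1 / 40 / ‖A δ‖) • A) δ‖ ≤ 1 / 40
      rw [norm_dilate_apply (by positivity), div_mul_cancel₀ _ hAδ.ne']
    · rw [norm_dilate_apply (by positivity), div_mul_cancel₀ _ hAδ.ne']

/-! ## The stub -/

/-- **S4 — DILATION REDUCTION** (`stub_dilation`): along the dilation family `s ↦ (sA, s⁻¹B)`, granted the
window geometry, `s¹⁰ · GR κ R (sA) (s⁻¹B) δ w = s⁻⁶P + Q − s¹⁰T − s⁸K` (`T = tailForm R w ≥ 0`,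
`K = 2κ Σ_nn Y_c ≥ 0`) is a concave function of `σ = s⁻⁶`, so its value at `s = 1`, which is `GR κ R A B δ w`,
dominates its value at one of the two dilation-extreme endpoints `s₀ ≤ 1 ≤ s₁` of the window. [folklore] -/
theorem stub_dilation : DilationReduction := by
  intro hWG κ hκ R A B δ w hW hδ
  obtain ⟨P, Q, N, hN, hkey⟩ := GR_dilate κ R A B δ w
  have hT : 0 ≤ tailForm R w := tailForm_nonneg R w
  have hK : 0 ≤ 2 * κ * N := by positivity
  have hG1 : GR κ R A B δ w = P + Q - tailForm R w - 2 * κ * N := by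
    have hg : ∀ c : BondClass, ¬ diagClass c →
        (c ∈ nnClasses ↔ ‖((1 : ℝ) • A) (bondVec δ c)‖ ≤ 11 / 10) := by
      rw [one_smul]; exact (hWG A δ hW hδ).1
    have h := hkey 1 one_pos hg
    simpa only [one_smul, inv_one, one_pow, one_mul] using h
  by_cases ha : 0 ≤ P + 5 / 3 * tailForm R w + 4 / 3 * (2 * κ * N)
  · obtain ⟨s, hs1, hE⟩ := exists_upper hW hδ
    have hs : 0 < s := one_pos.trans_le hs1
    refine ⟨s, hs, hE, ?_⟩
    rw [hkey s hs (hWG _ δ hE.1 hE.2.1).1, hG1]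
    have hσ : s⁻¹ ^ 6 ≤ 1 := pow_le_one₀ (inv_nonneg.mpr hs.le) (inv_le_one_of_one_le₀ hs1)
    have ht := tangent_bound P Q (tailForm R w) (2 * κ * N) hT hK hs
    nlinarith [mul_nonneg (sub_nonneg.mpr hσ) ha]
  · push Not at ha
    obtain ⟨s, hs, hs1, hE⟩ := exists_lower hW hδ
    refine ⟨s, hs, hE, ?_⟩
    rw [hkey s hs (hWG _ δ hE.1 hE.2.1).1, hG1]
    have hσ : 1 ≤ s⁻¹ ^ 6 := one_le_pow₀ ((one_le_inv₀ hs).mpr hs1)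
    have ht := tangent_bound P Q (tailForm R w) (2 * κ * N) hT hK hs
    nlinarith [mul_nonneg (sub_nonneg.mpr hσ) (neg_nonneg.mpr ha.le)]

end Summit.AtomisticToContinuum.Crystallization.Theorems.PhononStabilityCWC.DilationStub

end
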